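import Summits.BirchSwinnertonDyer.BirchSwinnertonDyer.Theorems.KatoDescentTamePotSupersingularJetchevIrreducibleReadingOfStubs
import Summits.BirchSwinnertonDyer.BirchSwinnertonDyer.Theorems.KatoDescentTamePotSupersingularJetchevIrreducibleReadingDivisibilityCoreVertexBridge
import Literature.NumberTheory.EllipticCurves.MatarNekovar2019.ShaStructureIrreducible
import HarnessLib

/-!
# Crux `JetchevIrreducibleReadingByName` (item 20165, shared K8-t′ / K9, cell `bsd-potss`): the DEEPEST BY-NAME CUT
# in the kernel — S1 named in Literature (MN19 Thm. 0.7/§0.11, p503175), S2 cut to «McCallum 5.2 + Jetchev 5.3 in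
# the irreducible reading» + «Thm. 6.3 for the row objects» (p504157 + the core-vertex bridge), held inputs by name
# (seat `bsd-potss-k8t-c4` g8; `--supports 20165`, helper; nothing booked, no item closed, BSD is not proved)

One theorem: the composition of `KatoDescentTamePotSupersingularJetchevIrreducibleReadingOfStubs` §3 (20165 ⟸ S1 ∧ S2
∧ `PublishedInputsHeegner`, p502280) with `…JetchevIrreducibleReadingDivisibilityCoreVertexBridge` §4 (S2 ⟸ h52I ∧
hCVI ∧ hRCF ∧ H63I) and the Literature name of S1. It records, as ONE kernel statement, exactly what the (H♯) input of
the rung routes `KatoDescentTamePotSupersingular` / `KatoDescentPotSupersingular` costs beyond the tree: a print-level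
structure theorem (named fact), two Čebotarev-type statements under absolute irreducibility (Jetchev Rem. 6.2's
claim; displayed, NOT binder swaps of the tree's surjective Čebotarev `McCallum1991_cor_3_2_pow_of_chebotarev`, which
uses `−1 ∈ ρ̄(Γ_K)`), and the Selmer-structure instantiation of Jetchev's §6 at an additive `p` (displayed). HONEST
FRAMING: conditional on every displayed binder; the crux, its stubs and BSD are exactly as open as before.

References: [cite: Jetchev2008, Cor. 1.5 (p. 812), Prop. 5.3, Thm. 5.2, Rem. 6.2] [cite: MatarNekovar2019, Thm. 0.7, §0.11]
[cite: McCallumLMS1991, §5 Prop. 5.2, Cor. 5.6].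
-/

set_option autoImplicit false
-- the Theorems directory repeats the summit name (sibling precedent `KatoDescentPotSupersingularAssembly.lean`)
set_option linter.dupNamespace false

noncomputable section

open scoped Classical

namespace Summit.BirchSwinnertonDyer.BirchSwinnertonDyer.Theorems.JetchevIrreducibleReadingDeepCut

open WeierstrassCurve Literature.NumberTheory.EllipticCurves
  Literature.NumberTheory.EllipticCurves.ModularForms
  Literature.NumberTheory.EllipticCurves.Rank1Residual
  Summit.BirchSwinnertonDyer.BirchSwinnertonDyer.Theorems

/-! ### The deepest BY-NAME cut: S1 named in Literature, S2 cut to two irreducible-reading Čebotarev statements + Thm. 6.3 for the row objects -/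

/-- **The shared crux `JetchevIrreducibleReadingByName` (item 20165) from its deepest kernel cut.** Inputs:
`hS` = S1 BY NAME, the Literature reading-level fact
`MatarNekovar2019.thm07_padicValNat_card_sha_primary_add_le_of_globalDivisibility_of_irreducible` (Kolyvagin's
structure theorem, upper half, under irreducibility, no reduction binder — MN19 Thm. 0.7 + §0.11; p503175);
`h52I` = McCallum 1991 Prop. 5.2 in the IRREDUCIBLE reading (displayed); `hCVI` = Jetchev 2008 Prop. 5.3 (core
vertices) in the IRREDUCIBLE reading at `p ∣ N` (displayed); `hRCF` = ring class fields of an imaginary quadratic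
field are number fields; `H63I` = [J] Thm. 5.2 (arXiv Thm. 6.3) FOR THE ROW OBJECTS with
`Core := Jetchev2008.IsGlobalCoreVertex` under S2's additive-`p` binders (the Selmer-structure instantiation of the
abstract §6 kernel — where «`p ∤ c_p`», Lemma 4.3 and [GZ III (3.1)] at `q ∥ N` live); `hH` = the route's held
`PublishedInputsHeegner`. Composition of `JetchevIrreducibleReadingOfStubs.jetchevIrreducibleReadingByName_of_structureIrred_of_divisibilityIrred_of_publishedInputsHeegner` (p502280 §3) with
`JetchevIrreducibleReadingDivisibility.divisibilityIrredAddv_of_prop52Irred_of_coreVertexExistenceIrred_of_thm63`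
(`…JetchevIrreducibleReadingDivisibilityCoreVertexBridge.lean`). So, in the kernel, the (H♯) input of both rung
routes reads: 20165 ⟸ {MN19 §0.11 structure theorem (named print-level fact)} ∧ {two Čebotarev-type statements
under absolute irreducibility (Jetchev Rem. 6.2's claim, displayed)} ∧ {Thm. 6.3 instantiated at an additive `p`}
∧ {Kolyvagin, modularity}. CONDITIONAL on every displayed binder; closes NOTHING; BSD is not proved for any curve.
[cite: Jetchev2008, Cor. 1.5 (p. 812), Prop. 5.3 (p. 823), Thm. 5.2 (p. 821), Rem. 6.2]
[cite: MatarNekovar2019, Thm. 0.7 and §0.11 (pp. 456–457)] [cite: McCallumLMS1991, §5 Prop. 5.2 (p. 304), Cor. 5.6 (p. 310)] -/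
theorem jetchevIrreducibleReadingByName_of_thm07_of_prop52Irred_of_coreVertexExistenceIrred_of_thm63
    (hS : MatarNekovar2019.thm07_padicValNat_card_sha_primary_add_le_of_globalDivisibility_of_irreducible)
    (h52I : ∀ (W : WeierstrassCurve ℚ) [W.IsElliptic] [W.IsGloballyMinimal] [NeZero (W.conductorNorm ℤ)],
        ¬ W.HasCM →
        ∀ (K : Type) [Field K] [NumberField K], IsImaginaryQuadratic K →
        NumberField.discr K ≠ -3 → NumberField.discr K ≠ -4 →
        SatisfiesHeegnerHypothesis (W.conductorNorm ℤ) K →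
        ∀ (p : ℕ) [Fact p.Prime], p ≠ 2 → W.HasIrreducibleModPGaloisRep p →
        ∀ (Dt : ModularParametrizationData W (W.conductorNorm ℤ)) (β : ℤ) (ι : K →+* ℂ)
          (d₁ : KolyvaginHeegnerData Dt β ι 1), ¬ IsOfFinAddOrder d₁.derivedPoint →
        ∀ (r : ℕ), 0 < r →
        ∀ (Mr : ℕ),
          IsLeast {u : ℕ | ∃ (n : ℕ) (d : KolyvaginHeegnerData Dt β ι n), Squarefree n ∧
              n.primeFactors.card = r ∧
              (∀ ℓ ∈ n.primeFactors, Zhang2014.IsKolyvaginPrime (W.conductorNorm ℤ) W K p ℓ ∧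
                u + 1 ≤ Zhang2014.kolyvaginIndex W p ℓ) ∧
              (∃ Q : (W.baseChange (ringClassField K ι n)).toAffine.Point,
                ((p ^ u : ℕ) : ℤ) • Q = d.derivedPoint) ∧
              ¬ ∃ Q : (W.baseChange (ringClassField K ι n)).toAffine.Point,
                ((p ^ (u + 1) : ℕ) : ℤ) • Q = d.derivedPoint} Mr →
        ∀ (M : ℕ), Mr < M →
          ∃ (n : ℕ) (d : KolyvaginHeegnerData Dt β ι n), Squarefree n ∧ n.primeFactors.card = r ∧
            (∀ ℓ ∈ n.primeFactors, Zhang2014.IsKolyvaginPrime (W.conductorNorm ℤ) W K p ℓ ∧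
              M ≤ Zhang2014.kolyvaginIndex W p ℓ) ∧
            addOrderOf (d.kolyvaginClass (Fact.out : p.Prime) M) = p ^ (M - Mr) ∧
            (∃ Q : (W.baseChange (ringClassField K ι n)).toAffine.Point,
              ((p ^ Mr : ℕ) : ℤ) • Q = d.derivedPoint) ∧
            ¬ ∃ Q : (W.baseChange (ringClassField K ι n)).toAffine.Point,
              ((p ^ (Mr + 1) : ℕ) : ℤ) • Q = d.derivedPoint)
    (hCVI : ∀ (W : WeierstrassCurve ℚ) [W.IsElliptic] [W.IsGloballyMinimal] [NeZero (W.conductorNorm ℤ)],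
        ¬ W.HasCM →
        ∀ (K : Type) [Field K] [NumberField K], IsImaginaryQuadratic K →
        NumberField.discr K ≠ -3 → NumberField.discr K ≠ -4 →
        SatisfiesHeegnerHypothesis (W.conductorNorm ℤ) K →
        ∀ (τ : K ≃ₐ[ℚ] K), τ ≠ 1 →
        ∀ (p : ℕ) [Fact p.Prime], p ≠ 2 → W.HasIrreducibleModPGaloisRep p →
        ∀ (Dt : ModularParametrizationData W (W.conductorNorm ℤ)) (β : ℤ) (ι : K →+* ℂ)
          [∀ k : ℕ, NumberField (ringClassField K ι k)]
          (d₁ : KolyvaginHeegnerData Dt β ι 1), ¬ IsOfFinAddOrder d₁.derivedPoint →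
        ∀ (m : ℕ), 1 ≤ m →
        ∀ (c : ℕ) (d : KolyvaginHeegnerData Dt β ι c), Squarefree c →
          (∀ ℓ ∈ c.primeFactors, Zhang2014.IsKolyvaginPrime (W.conductorNorm ℤ) W K p ℓ) →
        ∀ (s : ℕ), ¬ IsOfFinAddOrder d.derivedPoint →
          (∃ Q : (W.baseChange (ringClassField K ι c)).toAffine.Point,
            ((p ^ s : ℕ) : ℤ) • Q = d.derivedPoint) →
          (¬ ∃ Q : (W.baseChange (ringClassField K ι c)).toAffine.Point,
            ((p ^ (s + 1) : ℕ) : ℤ) • Q = d.derivedPoint) →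
          ((s + m : ℕ) : ℕ∞) ≤ Zhang2014.levelIndex W p c →
          ∃ (c' : ℕ) (d' : KolyvaginHeegnerData Dt β ι c'), Squarefree c' ∧
            (∀ ℓ ∈ c'.primeFactors, Zhang2014.IsKolyvaginPrime (W.conductorNorm ℤ) W K p ℓ ∧
              m + s ≤ Zhang2014.kolyvaginIndex W p ℓ) ∧
            Jetchev2008.IsGlobalCoreVertex W K ι τ p m c' ∧
            ¬ IsOfFinAddOrder d'.derivedPoint ∧
            ¬ ∃ Q : (W.baseChange (ringClassField K ι c')).toAffine.Point,
              ((p ^ (s + 1) : ℕ) : ℤ) • Q = d'.derivedPoint)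
    (hRCF : ∀ (K : Type) [Field K] [NumberField K] (ι : K →+* ℂ), IsImaginaryQuadratic K →
      ∀ k : ℕ, NumberField (ringClassField K ι k))
    (H63I : ∀ (W : WeierstrassCurve ℚ) [W.IsElliptic] [W.IsGloballyMinimal] [NeZero (W.conductorNorm ℤ)],
      ¬ W.HasCM → ∀ (K : Type) [Field K] [NumberField K], IsImaginaryQuadratic K →
      NumberField.discr K ≠ -3 → NumberField.discr K ≠ -4 →
      SatisfiesHeegnerHypothesis (W.conductorNorm ℤ) K →
      ∀ (τ : K ≃ₐ[ℚ] K), τ ≠ 1 →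
      ∀ (p : ℕ) [Fact p.Prime], p ≠ 2 → Rank1Residual.Addv W p → 0 ≤ padicValRat p W.j →
      W.HasIrreducibleModPGaloisRep p →
      ¬ p ∣ (W.baseChange ℚ_[p]).localTamagawaNumber ℤ_[p] →
      (∀ (q' : ℕ) [Fact q'.Prime], q' ∣ W.conductorNorm ℤ →
        p ∣ (W.baseChange ℚ_[q']).localTamagawaNumber ℤ_[q'] → ¬ q' ^ 2 ∣ W.conductorNorm ℤ) →
      ∀ (Dt : ModularParametrizationData W (W.conductorNorm ℤ)) (β : ℤ) (ι : K →+* ℂ)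
        [∀ k : ℕ, NumberField (ringClassField K ι k)]
        (d₁ : KolyvaginHeegnerData Dt β ι 1), ¬ IsOfFinAddOrder d₁.derivedPoint →
      ∀ (q : ℕ) [Fact q.Prime], q ∣ W.conductorNorm ℤ → ¬ q ^ 2 ∣ W.conductorNorm ℤ → q ≠ p →
      ∀ (mdiv m : {c : ℕ // Squarefree c ∧ ∀ ℓ ∈ c.primeFactors,
          Zhang2014.IsKolyvaginPrime (W.conductorNorm ℤ) W K p ℓ} → ℕ∞),
      (∀ c (u : ℕ), (u : ℕ∞) ≤ mdiv c ↔ ∀ d : KolyvaginHeegnerData Dt β ι c.1,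
        ∃ Q : (W.baseChange (ringClassField K ι c.1)).toAffine.Point,
          ((p ^ u : ℕ) : ℤ) • Q = d.derivedPoint) →
      (∀ c, m c = if mdiv c < Zhang2014.levelIndex W p c.1 then mdiv c else ⊤) →
      ∀ mInf : ℕ, (∀ c, (mInf : ℕ∞) ≤ m c) →
        (∀ m' : ℕ, ∃ c, (m' : ℕ∞) ≤ Zhang2014.levelIndex W p c.1 ∧ m c = mInf) →
      ∀ (k : ℕ) c, 1 ≤ k → Jetchev2008.IsGlobalCoreVertex W K ι τ p k c.1 → m c = mInf →
        (k : ℕ∞) + mInf ≤ Zhang2014.levelIndex W p c.1 →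
        padicValNat p ((W.baseChange ℚ_[q]).localTamagawaNumber ℤ_[q]) < k → mInf < k →
        padicValNat p ((W.baseChange ℚ_[q]).localTamagawaNumber ℤ_[q]) ≤ mInf)
    (hH : Theses.KatoDescentTamePotSupersingular.PublishedInputsHeegner) :
    Theses.KatoDescentTamePotSupersingular.JetchevIrreducibleReadingByName :=
  JetchevIrreducibleReadingOfStubs.jetchevIrreducibleReadingByName_of_structureIrred_of_divisibilityIrred_of_publishedInputsHeegner
    hS
    (JetchevIrreducibleReadingDivisibility.divisibilityIrredAddv_of_prop52Irred_of_coreVertexExistenceIrred_of_thm63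
      h52I hCVI hRCF H63I) hH

end Summit.BirchSwinnertonDyer.BirchSwinnertonDyer.Theorems.JetchevIrreducibleReadingDeepCut

end
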